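import Summits.MatrixMultiplication.OmegaCensus.SmallFormats.MatMul22nRankGF7Slack6FlatMain
import HarnessLib

/-!
# ω-census family (a): slack-6 certificate replay — MAIN CHECK (bucket completeness + level-1 expansion), file 13 of 114

Cell `pub-omega` (unit `pub-omega-tensor-g18`, `pub-omega-tensor-g19`), topic `Summits/MatrixMultiplication/OmegaCensus` (sub-folder `SmallFormats`).
Framing (verbatim): lottery ticket; floor = certified bounds/negative ranges. HONEST FRAMING: machine-generated kernel replay
(`pub-omega-tensor-g19/code/py/gen6_runs19.py`, from tensor g18's `gen6_runs18.py`): `LanesOK6 h 0 3692` (every lane of the total plane passes `laneOK6`) for the elements `34 ≤ h < 37` of `PGL₂(7)` (lane pieces `mainOK6K` (flat lane checker, literal plane) of ≤ 2400 level-1 loop nodes, 4614 in this file, glued by `lanesOK6_of_piece` / `lanesOK6_append`). Soundness is in `MatMul22nRankGF7Slack6SearchSound` /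
`MatMul22nRankGF7Slack6SearchFinal`; nothing here is progress on `ω`.
-/

namespace Summit.MatrixMultiplication.OmegaCensus.SmallFormats

set_option Elab.async false

set_option maxRecDepth 100000 in
set_option maxHeartbeats 400000000 in
/-- Element `34`: lanes `0 ≤ c < 3692` of the total plane pass (870 level-1 loop search nodes). -/
theorem mainOK6K_34_0 : mainOK6K 34 0 3692 = true := by decide +kernel

/-- **All 3 692 lanes of element `34` pass** (1 pieces; 870 loop search nodes). -/
theorem lanesOK6_h34 : LanesOK6 34 0 3692 := (lanesOK6_of_pieceK mainOK6K_34_0)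

set_option maxRecDepth 100000 in
set_option maxHeartbeats 400000000 in
/-- Element `35`: lanes `0 ≤ c < 3247` of the total plane pass (2396 level-1 loop search nodes). -/
theorem mainOK6K_35_0 : mainOK6K 35 0 3247 = true := by decide +kernel

set_option maxRecDepth 100000 in
set_option maxHeartbeats 400000000 in
/-- Element `35`: lanes `3247 ≤ c < 3692` of the total plane pass (277 level-1 loop search nodes). -/
theorem mainOK6K_35_1 : mainOK6K 35 3247 445 = true := by decide +kernel

/-- **All 3 692 lanes of element `35` pass** (2 pieces; 2673 loop search nodes). -/
theorem lanesOK6_h35 : LanesOK6 35 0 3692 := (lanesOK6_append (lanesOK6_of_pieceK mainOK6K_35_0) (lanesOK6_of_pieceK mainOK6K_35_1))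

set_option maxRecDepth 100000 in
set_option maxHeartbeats 400000000 in
/-- Element `36`: lanes `0 ≤ c < 3692` of the total plane pass (1071 level-1 loop search nodes). -/
theorem mainOK6K_36_0 : mainOK6K 36 0 3692 = true := by decide +kernel

/-- **All 3 692 lanes of element `36` pass** (1 pieces; 1071 loop search nodes). -/
theorem lanesOK6_h36 : LanesOK6 36 0 3692 := (lanesOK6_of_pieceK mainOK6K_36_0)

/-- **MAIN CHECK lanes for `34 ≤ · < 37`** (this file). -/
theorem lanesOK6_runM_13 : ∀ x, 34 ≤ x → x < 37 → LanesOK6 x 0 3692 := by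
  intro x _h1 h2
  by_cases g35 : x < 35
  · have e : x = 34 := by omega
    subst e; exact lanesOK6_h34
  by_cases g36 : x < 36
  · have e : x = 35 := by omega
    subst e; exact lanesOK6_h35
  have e : x = 36 := by omega
  subst e; exact lanesOK6_h36

end Summit.MatrixMultiplication.OmegaCensus.SmallFormats
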